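/-
Copyright (c) 2026 the pub-hodgecm-mathlib formalisation cell (harness21).  Prover seat hodgecm-mathlib-K2E3-p37 (g0), Track B «K2-LIT» ∕ h413 =
`stmt-HodgeConjecture-24833`, line `K2_E3_EllipticInputs`, unit U4 «Keys», PART «U4Keys» socket :182 (U4f-χ₁-ram-one-pos)
`sig_K2E3KeysThmTwoContractingRamifiedCharOnePosDepth` (LINE-LEAD K2E3-plan (g4) L4∕E3 EMIT #5 deal D163 2026-09-04T15:31:56Z; R0 census + addenda
`K2/K2E3-p37/g0/CENSUS-U4f-PosDepth.K2E3-p37-g0.md`): programme A_pos brick (v)-θ-CM «THE LEVEL-`n` IWAHORI CHARACTER ON `U(Φ₃)(L⁺_v)`» — `θ(g) = χ₁(g₀₀)` is multiplicative on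
`J_n = eA⁻¹(K₀ ⊓ g_nK₀g_n⁻¹)` for `χ₁` of conductor `≤ n` (the `n`-twin of ★ Z2A-3b `K2E3DepthZeroIwahoriCharacterCM` §1–§2; its §3 is level-free and cited).  REPORT-FIRST 2026-09-04.
-/
import Summits.HodgeConjecture.HodgeConjecture.Theorems.K2E3DepthZeroIwahoriCharacterCM   -- ★ Z2A-3b (K2E3-p06 (g4)): the (G3) frame, `coe_eA_apply`, `isUnit_of_apply_ne_zero`; §3 (`eA` on `w`, `N`, `N̄`; `θ = 1` on `N̄`; `θ` on `P`) is level-free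
import Summits.HodgeConjecture.HodgeConjecture.Theorems.K2E3LevelNIwahoriCharacter        -- ★∕📤 p861832 (this seat): model `v_mul_apply_zero_zero_sub_le_pow`, `apply_zero_zero_ne_zero_of_mem_pow`; brings ★ p861548 (`J_n`, pivot)
import HarnessLib

/-!
# K2 ∕ E3 «EllipticInputs», unit U4 «Keys» — (U4f-χ₁-ram-one-pos), programme A_pos brick (v)-θ-CM: THE LEVEL-`n` IWAHORI CHARACTER ON `U(Φ₃)(L⁺_v)` —
# `θ(g) = χ₁(g₀₀)` IS MULTIPLICATIVE ON `J_n = eA⁻¹(K₀ ⊓ g_nK₀g_n⁻¹)` FOR `χ₁` OF CONDUCTOR `≤ n`   [Roche1998 §3; MoyPrasad1996 §3; BruhatTits1972 (4.4.4); PlatonovRapinchuk1994 §5.1]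

Cell hodgecm-mathlib, Track B «K2-LIT», crux item H413 = stmt-HodgeConjecture-24833 (route `HCCMUnconditional`, no route verbs); target BY NAME the OPEN tier-0 leaf
`…K2E3EllipticInputs.U4Keys.sig_K2E3KeysThmTwoContractingRamifiedCharOnePosDepth` (U4Keys ED. 8 :182), design D-I «vanishing functional» at POSITIVE depth.  Author K2E3-p37 (g0).
`--supports stmt-HodgeConjecture-24833 --as helper`; THEOREMS ONLY.  Frame = the (G3)-EXPLICIT frame of ★ Z2A-3b `K2E3DepthZeroIwahoriCharacterCM` (`L v w hw eA heA ϖ hϖ g₁ hg₁ K0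
K1 I hK0 hK1 hI`) plus the level-`n` letters `gn hgn Jn hJn` of ★ p861811 `K2E3IwahoriLevelNLettersCM` (`Jn = K0 ⊓ eA⁻¹(g_nK₀g_n⁻¹ ∩ U_w)`).  NOT THE PAYER of :182.

THE POINT.  ★ V2b's letter `hθmul` wants `θ : G → ℂ`, `θ(g) := χ₁(g₀₀)` (if `g₀₀` is a unit of `L ⊗ L⁺_v`, else `0`), MULTIPLICATIVE on the type group.  At depth zero (type group
`I`, `χ₁` trivial on the principal units) this is ★ Z2A-3b `theta_mul`.  At POSITIVE depth the type group is `J_n` and the hypothesis is CONDUCTOR `≤ n` — `χ₁ u = 1` whenever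
`|u_{w′} − 1|_{w′} ≤ |ϖ|ⁿ` for all `w′ ∣ v` (one place `w`, `ϖ` its uniformiser; letter `hcond`): for `j, j′ ∈ J_n` the `w`-components satisfy `|(jj′)₀₀ − j₀₀j′₀₀|_w ≤ |ϖ|ⁿ` and
`|j₀₀|_w = |j′₀₀|_w = 1` (★∕📤 p861832 on the place-model `J_n`, read through `eA`, ★ `coe_eA_apply`), so `u = (jj′)₀₀∕(j₀₀j′₀₀)` has `|u − 1|_w ≤ |ϖ|ⁿ` and `χ₁ u = 1`.
* §1 `map_mem_inf_pow_of_mem` (`j ∈ J_n ⟹ eA j ∈` the place-model `J_n`), `isUnit_apply_zero_zero_of_mem_pow` (`j₀₀` is a unit of `L ⊗ L⁺_v` for `j ∈ J_n`, `1 ≤ n`).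
* §2 `v_mul_inv_sub_one_le` (`|a| = |b| = 1`, `|c − ab| ≤ B ⟹ |c∕(ab) − 1| ≤ B`), **`chi_unit_apply_zero_zero_mul_pow`**, **`theta_mul_pow`** (the letter `hθmul` at level `n`).
(The level-free letters — `θ = 1` on `eA⁻¹(N̄_w)`, `θ = τ` on `P ∩ J_n ⊆ P` — are ★ Z2A-3b §3 ∕ ★ Z2A-3c (iii) §2 verbatim and are not restated.)
HONEST LABEL: HC_CM is proved only modulo the 7 printed citations (2 remaining named inputs: hLiu418 = stmt-HodgeConjecture-24832, h413 = stmt-HodgeConjecture-24833)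
until rung 0 closes; count-neutral — this file does NOT pay the leaf; no printed citation is discharged.

## References
* [Roche1998] A. Roche, *Types and Hecke algebras for principal series representations of split reductive p-adic groups*, Ann. Sci. ÉNS (4) 31 (1998), §3 (the character `χ̃` of `J_χ`).
* [MoyPrasad1996] A. Moy, G. Prasad, *Jacquet functors and unrefined minimal K-types*, Comment. Math. Helv. 71 (1996), §3.
* [BruhatTits1972] F. Bruhat, J. Tits, *Groupes réductifs sur un corps local I*, Publ. Math. IHÉS 41 (1972), (4.4.4).
* [PlatonovRapinchuk1994] V. Platonov, A. Rapinchuk, *Algebraic Groups and Number Theory* (1994), §5.1.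
-/

set_option autoImplicit false
-- the mandated namespace has the single-problem summit's repeated segment (`HodgeConjecture.HodgeConjecture`)
set_option linter.dupNamespace false

noncomputable section

open NumberField IsDedekindDomain
open scoped Matrix MatrixGroups WithZero Valued
open Literature.NumberTheory Literature.NumberTheory.Automorphic Literature.NumberTheory.Automorphic.UnitaryGroup
open Literature.NumberTheory.Rogawski1990

namespace Summit.HodgeConjecture.HodgeConjecture.Cruxes.H413.K2E3LevelNIwahoriCharacterCM

open Summit.HodgeConjecture.HodgeConjecture.Cruxes.H413
open Summit.HodgeConjecture.HodgeConjecture.Cruxes.H413.K2E3DepthZeroIwahoriCharacterCM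

variable (L : Type) [Field L] [NumberField L] [IsCMField L] (v : HeightOneSpectrum (𝓞 ↥(maximalRealSubfield L)))
  (w : PlacesOver L v) (hw : IsCMField.complexConj L • w.1 = w.1)
  (eA : Gqs L v ≃ₜ* ↥(unitaryGroupOfForm (galAdicCompletionMap (L := L) (IsCMField.complexConj L) hw) ((StdForm.antidiagonal 3).over (w.1.adicCompletion L))))
  (heA : ∀ g : Gqs L v,
    ((eA g : ↥(unitaryGroupOfForm (galAdicCompletionMap (L := L) (IsCMField.complexConj L) hw) ((StdForm.antidiagonal 3).over (w.1.adicCompletion L)))) :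
        GL (Fin 3) (w.1.adicCompletion L)) =
      ((localNonsplitEquiv (IsCMField.complexConj L) (qsForm L) (IsCMField.complexConj_ne_one L) w hw g :
        ↥(unitaryGroupOfForm (galAdicCompletionMap (L := L) (IsCMField.complexConj L) hw) (placeForm (qsForm L) w.1))) : GL (Fin 3) (w.1.adicCompletion L)))
  {ϖ : w.1.adicCompletion L} (hϖ : Valued.v ϖ = WithZero.exp (-1 : ℤ))
  (K0 : Subgroup (Gqs L v))
  (hK0 : K0 = ((glInt 3 (w.1.adicCompletion L)).subgroupOf
    (unitaryGroupOfForm (galAdicCompletionMap (L := L) (IsCMField.complexConj L) hw) ((StdForm.antidiagonal 3).over (w.1.adicCompletion L)))).comap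
      eA.toMulEquiv.toMonoidHom)
  {n : ℕ} (gn : GL (Fin 3) (w.1.adicCompletion L))
  (hgn : (gn : Matrix (Fin 3) (Fin 3) (w.1.adicCompletion L)) = Matrix.diagonal ![(1 : w.1.adicCompletion L), 1, ϖ ^ n])
  (Jn : Subgroup (Gqs L v))
  (hJn : Jn = K0 ⊓ (((glInt 3 (w.1.adicCompletion L)).map (MulAut.conj gn).toMonoidHom).subgroupOf
    (unitaryGroupOfForm (galAdicCompletionMap (L := L) (IsCMField.complexConj L) hw) ((StdForm.antidiagonal 3).over (w.1.adicCompletion L)))).comap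
      eA.toMulEquiv.toMonoidHom)

/-! ## §1 `eA` sends `J_n` into the place-model `J_n`; the `(0,0)` entry on `J_n` is a unit -/

include hK0 hJn in
/-- `j ∈ J_n = K0 ⊓ eA⁻¹(g_nK₀g_n⁻¹ ∩ U_w)` ⟹ `eA j` lies in the place-model level-`n` Iwahori `(GL₃(𝒪) ∩ U_w) ⊓ (g_n GL₃(𝒪) g_n⁻¹ ∩ U_w)` (★ p861548). [cite: BruhatTits1972, (4.4.4)] -/
theorem map_mem_inf_pow_of_mem {j : Gqs L v} (hj : j ∈ Jn) :
    eA j ∈ (glInt 3 (w.1.adicCompletion L)).subgroupOf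
        (unitaryGroupOfForm (galAdicCompletionMap (L := L) (IsCMField.complexConj L) hw) ((StdForm.antidiagonal 3).over (w.1.adicCompletion L))) ⊓
      ((glInt 3 (w.1.adicCompletion L)).map (MulAut.conj gn).toMonoidHom).subgroupOf
        (unitaryGroupOfForm (galAdicCompletionMap (L := L) (IsCMField.complexConj L) hw) ((StdForm.antidiagonal 3).over (w.1.adicCompletion L))) := by
  subst hJn hK0
  exact Subgroup.mem_inf.2 ⟨(Subgroup.mem_inf.1 hj).1, (Subgroup.mem_inf.1 hj).2⟩

include heA hϖ hK0 hgn hJn in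
/-- **For `j ∈ J_n` (`1 ≤ n`) the entry `j₀₀ ∈ L ⊗ L⁺_v` is a unit** (its `w`-component `(eA j)₀₀` is a `w`-adic unit, ★∕📤 p861832 `apply_zero_zero_ne_zero_of_mem_pow`; ★
`isUnit_of_apply_ne_zero` at the non-split `v`). [cite: BruhatTits1972, (4.4.4)] [cite: PlatonovRapinchuk1994, §5.1] -/
theorem isUnit_apply_zero_zero_of_mem_pow (hn : 1 ≤ n) {j : Gqs L v} (hj : j ∈ Jn) :
    IsUnit (((j.val : GL (Fin 3) (LocalRing L v)) : Matrix (Fin 3) (Fin 3) (LocalRing L v)) 0 0) := by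
  refine isUnit_of_apply_ne_zero L v w hw _ ?_
  rw [← coe_eA_apply L v w hw eA heA j 0 0]
  exact K2E3LevelNIwahoriCharacter.apply_zero_zero_ne_zero_of_mem_pow (galAdicCompletionMap (L := L) (IsCMField.complexConj L) hw) rfl
    (fun x => valued_galAdicCompletionMap (L := L) (IsCMField.complexConj L) hw x) hϖ gn hgn hn
    (map_mem_inf_pow_of_mem L v w hw eA K0 hK0 gn Jn hJn hj)

/-! ## §2 Multiplicativity of `θ(g) = χ₁(g₀₀)` on `J_n` for `χ₁` of conductor `≤ n` -/

/-- `|a| = |b| = 1`, `|c − ab| ≤ B` ⟹ `|c∕(ab) − 1| ≤ B`. [cite: Roche1998, §3] -/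
theorem v_mul_inv_sub_one_le {K : Type*} [Field K] [Valued K ℤᵐ⁰] {a b c : K} {B : ℤᵐ⁰}
    (ha : Valued.v a = 1) (hb : Valued.v b = 1) (hc : Valued.v (c - a * b) ≤ B) (ha0 : a ≠ 0) (hb0 : b ≠ 0) :
    Valued.v (c * (a * b)⁻¹ - 1) ≤ B := by
  rw [show c * (a * b)⁻¹ - 1 = (c - a * b) * (a * b)⁻¹ by rw [sub_mul, mul_inv_cancel₀ (mul_ne_zero ha0 hb0)],
    map_mul, map_inv₀, map_mul, ha, hb, mul_one, inv_one, mul_one]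
  exact hc

include heA hϖ hK0 hgn hJn in
/-- **`χ₁((jj′)₀₀) = χ₁(j₀₀)·χ₁(j′₀₀)` for `j, j′ ∈ J_n`** (`1 ≤ n`) when `χ₁` has CONDUCTOR `≤ n` (`χ₁ u = 1` whenever `|u_{w′} − 1| ≤ |ϖ|ⁿ` for all `w′ ∣ v`): the quotient
`u = (jj′)₀₀ ∕ (j₀₀ j′₀₀)` satisfies `|u − 1|_w ≤ |ϖ|ⁿ` at the one place `w` (★∕📤 p861832 `v_mul_apply_zero_zero_sub_le_pow` and the pivot on the place-model `J_n`, read through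
`eA`). [cite: Roche1998, §3] [cite: MoyPrasad1996, §3] -/
theorem chi_unit_apply_zero_zero_mul_pow (hn : 1 ≤ n) (χ₁ : (LocalRing L v)ˣ →* ℂˣ)
    (hcond : ∀ u : (LocalRing L v)ˣ, (∀ w' : PlacesOver L v, Valued.v (((u : LocalRing L v) w') - 1) ≤ Valued.v ϖ ^ n) → χ₁ u = 1)
    {j j' : Gqs L v} (hj : j ∈ Jn) (hj' : j' ∈ Jn)
    (h0 : IsUnit ((((j * j').val : GL (Fin 3) (LocalRing L v)) : Matrix (Fin 3) (Fin 3) (LocalRing L v)) 0 0))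
    (h1 : IsUnit (((j.val : GL (Fin 3) (LocalRing L v)) : Matrix (Fin 3) (Fin 3) (LocalRing L v)) 0 0))
    (h2 : IsUnit (((j'.val : GL (Fin 3) (LocalRing L v)) : Matrix (Fin 3) (Fin 3) (LocalRing L v)) 0 0)) :
    χ₁ h0.unit = χ₁ h1.unit * χ₁ h2.unit := by
  have hvσ : ∀ x, Valued.v (galAdicCompletionMap (L := L) (IsCMField.complexConj L) hw x) = Valued.v x :=
    fun x => valued_galAdicCompletionMap (L := L) (IsCMField.complexConj L) hw x
  have hjI := map_mem_inf_pow_of_mem L v w hw eA K0 hK0 gn Jn hJn hj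
  have hj'I := map_mem_inf_pow_of_mem L v w hw eA K0 hK0 gn Jn hJn hj'
  -- the three entries at the place `w`
  have ha : Valued.v (((j.val : GL (Fin 3) (LocalRing L v)) : Matrix (Fin 3) (Fin 3) (LocalRing L v)) 0 0 w) = 1 := by
    rw [← coe_eA_apply L v w hw eA heA j 0 0]
    exact K2E3IwahoriLevelNFactorisation.v_apply_zero_zero_eq_one_of_mem_inf_pow _ rfl hvσ hϖ gn hgn hn hjI
  have hb : Valued.v (((j'.val : GL (Fin 3) (LocalRing L v)) : Matrix (Fin 3) (Fin 3) (LocalRing L v)) 0 0 w) = 1 := by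
    rw [← coe_eA_apply L v w hw eA heA j' 0 0]
    exact K2E3IwahoriLevelNFactorisation.v_apply_zero_zero_eq_one_of_mem_inf_pow _ rfl hvσ hϖ gn hgn hn hj'I
  have hc : Valued.v ((((j * j').val : GL (Fin 3) (LocalRing L v)) : Matrix (Fin 3) (Fin 3) (LocalRing L v)) 0 0 w -
      ((j.val : GL (Fin 3) (LocalRing L v)) : Matrix (Fin 3) (Fin 3) (LocalRing L v)) 0 0 w *
        ((j'.val : GL (Fin 3) (LocalRing L v)) : Matrix (Fin 3) (Fin 3) (LocalRing L v)) 0 0 w) ≤ Valued.v ϖ ^ n := by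
    rw [← coe_eA_apply L v w hw eA heA (j * j') 0 0, ← coe_eA_apply L v w hw eA heA j 0 0, ← coe_eA_apply L v w hw eA heA j' 0 0, map_mul]
    exact K2E3LevelNIwahoriCharacter.v_mul_apply_zero_zero_sub_le_pow _ rfl hvσ hϖ gn hgn hjI hj'I
  have ha0 : ((j.val : GL (Fin 3) (LocalRing L v)) : Matrix (Fin 3) (Fin 3) (LocalRing L v)) 0 0 w ≠ 0 := fun h => by
    rw [h, map_zero] at ha; exact zero_ne_one ha
  have hb0 : ((j'.val : GL (Fin 3) (LocalRing L v)) : Matrix (Fin 3) (Fin 3) (LocalRing L v)) 0 0 w ≠ 0 := fun h => by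
    rw [h, map_zero] at hb; exact zero_ne_one hb
  -- the quotient is congruent to `1` modulo `𝔭ⁿ` at the one place `w`
  have hu : ∀ w' : PlacesOver L v, Valued.v ((((h0.unit * (h1.unit * h2.unit)⁻¹ : (LocalRing L v)ˣ)) : LocalRing L v) w' - 1) ≤ Valued.v ϖ ^ n := by
    intro w'
    obtain rfl := (PlacesOver.eq_of_smul_eq (IsCMField.complexConj L) (IsCMField.complexConj_ne_one L) w hw w').symm
    rw [Units.val_mul, Units.val_inv_eq_inv_val, Units.val_mul, IsUnit.unit_spec, IsUnit.unit_spec, IsUnit.unit_spec, Pi.mul_apply, Pi.inv_apply,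
      Pi.mul_apply]
    exact v_mul_inv_sub_one_le ha hb hc ha0 hb0
  have h := hcond _ hu
  rw [map_mul, map_inv, mul_inv_eq_one] at h
  rw [h, map_mul]

open Classical in
include heA hϖ hK0 hgn hJn in
/-- **`θ(jj′) = θ(j)·θ(j′)` on `J_n`** (`1 ≤ n`) for `θ(g) := if h : IsUnit g₀₀ then χ₁(h.unit) else 0` and `χ₁` of conductor `≤ n` — the letter `hθmul` of ★ V2b at `B = J_n`, the
level-`n` twin of ★ Z2A-3b `theta_mul`. [cite: Roche1998, §3] [cite: MoyPrasad1996, §3] -/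
theorem theta_mul_pow (hn : 1 ≤ n) (χ₁ : (LocalRing L v)ˣ →* ℂˣ)
    (hcond : ∀ u : (LocalRing L v)ˣ, (∀ w' : PlacesOver L v, Valued.v (((u : LocalRing L v) w') - 1) ≤ Valued.v ϖ ^ n) → χ₁ u = 1)
    {j j' : Gqs L v} (hj : j ∈ Jn) (hj' : j' ∈ Jn) :
    (if h : IsUnit ((((j * j').val : GL (Fin 3) (LocalRing L v)) : Matrix (Fin 3) (Fin 3) (LocalRing L v)) 0 0) then ((χ₁ h.unit : ℂˣ) : ℂ) else 0) =
      (if h : IsUnit (((j.val : GL (Fin 3) (LocalRing L v)) : Matrix (Fin 3) (Fin 3) (LocalRing L v)) 0 0) then ((χ₁ h.unit : ℂˣ) : ℂ) else 0) *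
        (if h : IsUnit (((j'.val : GL (Fin 3) (LocalRing L v)) : Matrix (Fin 3) (Fin 3) (LocalRing L v)) 0 0) then ((χ₁ h.unit : ℂˣ) : ℂ) else 0) := by
  have h0 := isUnit_apply_zero_zero_of_mem_pow L v w hw eA heA hϖ K0 hK0 gn hgn Jn hJn hn (Subgroup.mul_mem _ hj hj')
  have h1 := isUnit_apply_zero_zero_of_mem_pow L v w hw eA heA hϖ K0 hK0 gn hgn Jn hJn hn hj
  have h2 := isUnit_apply_zero_zero_of_mem_pow L v w hw eA heA hϖ K0 hK0 gn hgn Jn hJn hn hj'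
  rw [dif_pos h0, dif_pos h1, dif_pos h2, ← Units.val_mul,
    chi_unit_apply_zero_zero_mul_pow L v w hw eA heA hϖ K0 hK0 gn hgn Jn hJn hn χ₁ hcond hj hj' h0 h1 h2]

end Summit.HodgeConjecture.HodgeConjecture.Cruxes.H413.K2E3LevelNIwahoriCharacterCM

end
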